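import Summits.BirchSwinnertonDyer.Rank1Residual.X1.MuLambda
import Literature.NumberTheory.EllipticCurves.Greenberg1999.MuLowerBound
import Literature.NumberTheory.EllipticCurves.Rank1Residual.GVParityTwistProofs
import HarnessLib

/-!
# Class X1 ∩ {r = 0}: the μ-STRUCTURE of a leaf class in the kernel — where Greenberg–Vatsal's
# `μ = 0` mechanism (covered row C7) provably stops (sub-cell `eisenstein-p1`, gen 2)

HONEST FRAMING (cell `b2b-bsdres`, run/shared/lean/b2b/bsd-rank1-residual/, verbatim in every
file): the goal of the cell is to DELETE the COMBINATION-SHAPED residual classes of the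
Birch–Swinnerton-Dyer formula for ALL analytic-rank `≤ 1` elliptic curves over `ℚ` — "full BSD
formula for every rank `≤ 1` curve in class `C`" assembled STRICTLY from published theorems — so
that the rank-`≤ 1` remainder becomes exactly the CONSTRUCTION-SHAPED classes, which are TYPED
(missing-input `Prop`s), NOT attempted. This is not "finishing BSD". CLASS-OWNERS.md: research
route; NO CLAIM BEYOND STATED CLASSES. Nothing below changes a label.

WHY. The covered neighbour C7 of the leaf (anomalous ∧ gvpar ∧ r = 0) is closed by Greenberg–
Vatsal's Thm. (1.3), whose engine is `μ_alg = μ_an = 0` (Greenberg LNM 1716 Prop. 5.10 +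
Ferrero–Washington) followed by a λ-count. HOME/b2b-bsdres-eisenstein-p1/X1R0-GAPMAP.md §3A locates
where the parity enters; this file puts the STRUCTURAL half of that diagnosis in the kernel, from
PUBLISHED named facts only:

* `lineType_of_not_gvPar` — on a pair of parity type A (`¬ GVPar W p`), EVERY rational line
  `Φ ≤ E[p]` is either (unramified at `p` ∧ even) or (ramified at `p` ∧ odd): pure logic from
  `lineEven_or_lineOdd` (x1a) and the definition of `GVPar`. So Prop. 5.10's hypothesis (a line that
  is ramified-even or unramified-odd) is NEVER available on the leaf, at any member of the class.
* `one_le_mu_of_leaf_of_ramified_line` — at a leaf pair whose curve carries a RAMIFIED rational line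
  (the `ψ`-members of the class, e.g. `11a1`, `11a2` at `5`, `14a1` at `3`), the algebraic
  μ-invariant of `X(E/ℚ_∞)` is `≥ 1`, by Greenberg LNM 1716 Prop. 5.7 (= Greenberg–Vatsal's Thm. B;
  tree fact `Greenberg1999.prop57_one_le_mu_of_ramified_odd_line`, `m = 1`), granted `Λ`-torsion;
  `not_hasUnitContent_of_leaf_of_ramified_line` — equivalently NO generator of `char_Λ X(E/ℚ_∞)` has
  unit content (Greenberg–Vatsal's "`μ_alg = 0`" FAILS there);
* `padicLFunction_coeff_norm_lt_one_of_leaf_of_ramified_line` — with Wuthrich 2014 Thm. 16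
  (Kato's divisibility integrally at a reducible prime, tree fact
  `Wuthrich2014.charIdeal_dvd_padicLFunction`, which also supplies the `Λ`-torsion): EVERY
  coefficient of the Néron-normalised `p`-adic `L`-function `ϖ · L_p(f, α)` of such a member has
  `p`-adic norm `< 1` — "`μ_an ≥ 1`", an Eisenstein congruence `L_p(E,T) ≡ 0 (mod p)` obtained
  ALGEBRAICALLY (Prop. 5.7 + Kato–Wuthrich), the kernel form of the cell's census finding
  (iw-2, IWASAWA-CENSUS part II §4: `μ_an = m_E ≥ 1` at every member with a ramified line, e.g. the
  22 listed curves `14a1@3`, `11a1@5`, …).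

So on every leaf class the `μ = 0` route is closed at the `ψ`-members by a THEOREM, and at the
`φ`-members (unramified-even line; Greenberg's conjecture predicts `μ = 0` there) no published
theorem gives `μ = 0` — the μ-part of HOME/…/X1R0-GAPMAP.md §5 in the kernel's vocabulary
(`X1/MuLambda.lean`: `MazurMainConjecture ↔ MuPartAt ∧ LambdaPartAt`). No label change.

References: [GreenbergLNM1716] Props. 5.7, 5.10 (PDF pp. 139, 147); [GreenbergVatsal2000] p. 18
(results B, C), §2 p. 28; [Wuthrich2014] Thm. 16; HOME/b2b-bsdres-eisenstein-p1/X1R0-GAPMAP.md §3A, §5;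
HOME/b2b-bsdres-iw-2/IWASAWA-CENSUS.md part II.
-/

noncomputable section

open scoped Classical MatrixGroups ModularForm

open CongruenceSubgroup WeierstrassCurve Literature.NumberTheory.EllipticCurves
  Literature.NumberTheory.EllipticCurves.ModularForms
  Literature.NumberTheory.EllipticCurves.Rank1Residual
  Literature.NumberTheory.EllipticCurves.GreenbergVatsal2000
  Literature.NumberTheory.EllipticCurves.Greenberg1999
  Summit.BirchSwinnertonDyer.BirchSwinnertonDyer.Theorems.Rank1ResidualX1Defs

set_option autoImplicit false

namespace Summit.BirchSwinnertonDyer.Rank1Residual.X1.MuStructure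

variable {W : WeierstrassCurve ℚ} [W.IsElliptic] [W.IsGloballyMinimal] {p : ℕ} [Fact p.Prime]

/-! ## §1. Line types on a parity-type-A pair -/

omit [W.IsElliptic] [W.IsGloballyMinimal] in
/-- **On a pair of parity type A every rational line is unramified-even or ramified-odd.** If
`¬ GVPar W p` (no rational `p`-isogeny kernel of type (ramified ∧ even) ∨ (unramified ∧ odd)) and
`Φ ≤ E[p]` is a rational line, then `Φ` is (unramified at `p` ∧ even) or (ramified at `p` ∧ odd):
a rational line is even or odd (`lineEven_or_lineOdd`, complex conjugations act by `±1`), and the two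
mixed types are excluded by `¬ GVPar`. In Greenberg–Vatsal's notation: the characters of `E[p]^{ss}`
are `φ` (unramified, even) and `ψ = ωφ⁻¹` (ramified, odd). [cite: GreenbergVatsal2000, §2 p. 28 ("one of the characters is even, one odd; one ramified at p, the other unramified")] -/
theorem lineType_of_not_gvPar (hA : ¬ GVPar W p) {Φ : AddSubgroup (geomTorsion W (p : ℤ))}
    (hΦ : IsRationalLine W p Φ) :
    (LineUnramifiedAt W p Φ ∧ LineEven W p Φ) ∨ (¬ LineUnramifiedAt W p Φ ∧ LineOdd W p Φ) := by
  rcases lineEven_or_lineOdd hΦ with heven | hodd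
  · by_cases hunr : LineUnramifiedAt W p Φ
    · exact Or.inl ⟨hunr, heven⟩
    · exact absurd ⟨Φ, hΦ, Or.inl ⟨hunr, heven⟩⟩ hA
  · by_cases hunr : LineUnramifiedAt W p Φ
    · exact absurd ⟨Φ, hΦ, Or.inr ⟨hunr, hodd⟩⟩ hA
    · exact Or.inr ⟨hunr, hodd⟩

omit [W.IsElliptic] [W.IsGloballyMinimal] in
/-- On a type-A pair, a RAMIFIED rational line is odd (the `ψ`-line). [cite: GreenbergVatsal2000, §2 p. 28] -/
theorem lineOdd_of_not_gvPar_of_ramified (hA : ¬ GVPar W p)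
    {Φ : AddSubgroup (geomTorsion W (p : ℤ))} (hΦ : IsRationalLine W p Φ)
    (hram : ¬ LineUnramifiedAt W p Φ) : LineOdd W p Φ := by
  rcases lineType_of_not_gvPar hA hΦ with ⟨hunr, -⟩ | ⟨-, hodd⟩
  · exact absurd hunr hram
  · exact hodd

omit [W.IsElliptic] [W.IsGloballyMinimal] in
/-- On a type-A pair, an UNRAMIFIED rational line is even (the `φ`-line). [cite: GreenbergVatsal2000, §2 p. 28] -/
theorem lineEven_of_not_gvPar_of_unramified (hA : ¬ GVPar W p)
    {Φ : AddSubgroup (geomTorsion W (p : ℤ))} (hΦ : IsRationalLine W p Φ)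
    (hunr : LineUnramifiedAt W p Φ) : LineEven W p Φ := by
  rcases lineType_of_not_gvPar hA hΦ with ⟨-, heven⟩ | ⟨hram, -⟩
  · exact heven
  · exact absurd hunr hram

omit [W.IsElliptic] in
/-- On the leaf, Greenberg's Prop. 5.10 hypothesis is never met: no rational line of a leaf curve
is (ramified ∧ even) or (unramified ∧ odd). [cite: GreenbergLNM1716, Prop. 5.10 (PDF p. 147) (the hypothesis)] -/
theorem not_prop510Hypothesis_of_leaf (hL : RankZero.Leaf W p)
    {Φ : AddSubgroup (geomTorsion W (p : ℤ))} (hΦ : IsRationalLine W p Φ) :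
    ¬ ((¬ LineUnramifiedAt W p Φ ∧ LineEven W p Φ) ∨ (LineUnramifiedAt W p Φ ∧ LineOdd W p Φ)) :=
  fun h ↦ hL.not_gvPar ⟨Φ, hΦ, h⟩

/-! ## §2. `μ ≥ 1` at the members carrying the ramified line (Greenberg Prop. 5.7) -/

/-- **`μ_alg ≥ 1` at a leaf curve with a ramified rational line.** For a leaf pair `(E,p)` whose
curve has a rational line `Φ ≤ E[p]` RAMIFIED at `p` (then odd, by type A), granted Greenberg LNM
1716 Prop. 5.7 (`h57`, PUBLISHED named fact, `m = 1`): for the cyclotomic `ℤ_p`-extension and every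
dual datum `D` of `Sel_{p^∞}(E/ℚ_∞)` that is `Λ`-torsion, `1 ≤ μ(X(E/ℚ_∞))`. (Leaf ⇒ `p ≠ 2`, good
ordinary.) [cite: GreenbergLNM1716, Prop. 5.7 (PDF p. 139)] [cite: GreenbergVatsal2000, p. 18 (result B)] -/
theorem one_le_mu_of_leaf_of_ramified_line (h57 : prop57_one_le_mu_of_ramified_odd_line)
    (hL : RankZero.Leaf W p) {Φ : AddSubgroup (geomTorsion W (p : ℤ))} (hΦ : IsRationalLine W p Φ)
    (hram : ¬ LineUnramifiedAt W p Φ) {κ : ZpExtension ℚ p} {γ : Field.absoluteGaloisGroup ℚ}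
    (hκ : κ.IsCyclotomic) (hγ : κ.IsTopGenerator γ) (D : W.SelmerDualData κ γ) (hD : D.IsTorsion) :
    1 ≤ D.mu :=
  have hX := isClassX1_of_classX1 hL.classX1
  h57.of_goodOrd W p hX.two_ne hX.hasGoodReductionAtPrime hX.not_dvd_frobeniusTrace hΦ hram
    (lineOdd_of_not_gvPar_of_ramified hL.not_gvPar hΦ hram) hκ hγ D hD

/-- **Greenberg–Vatsal's "`μ_alg = 0`" FAILS at a leaf curve with a ramified line:** no generator of
`char_Λ X(E/ℚ_∞)` has unit content (`p` divides all of them), granted Prop. 5.7 (`h57`) and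
`Λ`-torsion. [cite: GreenbergLNM1716, Prop. 5.7 (PDF p. 139)] [cite: GreenbergVatsal2000, p. 2, (1)–(2)] -/
theorem not_hasUnitContent_of_leaf_of_ramified_line (h57 : prop57_one_le_mu_of_ramified_odd_line)
    (hL : RankZero.Leaf W p) {Φ : AddSubgroup (geomTorsion W (p : ℤ))} (hΦ : IsRationalLine W p Φ)
    (hram : ¬ LineUnramifiedAt W p Φ) {κ : ZpExtension ℚ p} {γ : Field.absoluteGaloisGroup ℚ}
    (hκ : κ.IsCyclotomic) (hγ : κ.IsTopGenerator γ) (D : W.SelmerDualData κ γ) (hD : D.IsTorsion)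
    {g : IwasawaAlgebra p} (hg : D.charIdeal = Ideal.span {g}) : ¬ HasUnitContent g := by
  haveI : Module.Finite (IwasawaAlgebra p) D.X := D.module_finite_holds hγ
  have hX := isClassX1_of_classX1 hL.classX1
  have hdvd : PowerSeries.C (p : ℤ_[p]) ∣ g :=
    h57.C_dvd_of_charIdeal_eq W p hX.two_ne
      (Or.inl ⟨hX.hasGoodReductionAtPrime, hX.not_dvd_frobeniusTrace⟩) hΦ hram
      (lineOdd_of_not_gvPar_of_ramified hL.not_gvPar hΦ hram) hκ hγ D hD hg
  exact fun hu ↦ (hasUnitContent_iff_not_C_dvd g).mp hu hdvd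

/-! ## §3. `μ_an ≥ 1` there: `p` divides the Néron-normalised `p`-adic `L`-function (Prop. 5.7 + Kato–Wuthrich) -/

/-- Norms of the coefficients of `ι(p · q)`: every coefficient of the image in `ℚ_p⟦T⟧` of a
multiple of `p` in `Λ` has norm `< 1`. [folklore] -/
theorem norm_coeff_map_lt_one_of_C_dvd {g : IwasawaAlgebra p} (h : PowerSeries.C (p : ℤ_[p]) ∣ g)
    (n : ℕ) : ‖PowerSeries.coeff n (iwasawaToPowerSeries p g)‖ < 1 := by
  obtain ⟨q, rfl⟩ := h
  rw [PowerSeries.coeff_map, PowerSeries.coeff_C_mul, map_mul, map_natCast, norm_mul]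
  have hq : ‖algebraMap ℤ_[p] ℚ_[p] (PowerSeries.coeff n q)‖ ≤ 1 := PadicInt.norm_le_one _
  have hpn : ‖(p : ℚ_[p])‖ < 1 := Padic.norm_p_lt_one
  calc ‖(p : ℚ_[p])‖ * ‖algebraMap ℤ_[p] ℚ_[p] (PowerSeries.coeff n q)‖
      ≤ ‖(p : ℚ_[p])‖ * 1 := by gcongr
    _ < 1 := by rw [mul_one]; exact hpn

/-- **`μ_an ≥ 1` at a leaf curve with a ramified line: `L_p(E,T) ≡ 0 (mod p)`.** For a leaf pair
`(E,p)` whose curve carries a RAMIFIED rational line, granted Greenberg Prop. 5.7 (`h57`) and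
Wuthrich 2014 Thm. 16 (`hW16`: `X(E/ℚ_∞)` is `Λ`-torsion and `ϖ·L_p(f,α) = ι(g')` with
`g' ∈ char_Λ X`, integrally, at a reducible prime `p ≠ 2` semistable at `p`) — both PUBLISHED —:
for the cyclotomic data `κ, γ`, the newform `f` of `E`, every `ϖ ∈ ℚ` with `ϖ·Ω_E = Ω⁺_f` (so that
`ϖ·L_p(f,α)` is the Mazur–Swinnerton-Dyer `p`-adic `L`-function for the Néron period) and every dual
datum `D`, EVERY coefficient of `ϖ·L_p(f,α)` has `p`-adic norm `< 1`. Proof: `char X = (g)` is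
principal, `g ∣ g'`, `p ∣ g` (Prop. 5.7 in reading (2)), so `p ∣ g'`. This is the analytic twin of
Greenberg–Vatsal's Thm. B obtained algebraically; on the census it is iw-2's `μ_an = m_E ≥ 1` at every
member with a ramified line. [cite: GreenbergLNM1716, Prop. 5.7 (PDF p. 139)] [cite: Wuthrich2014, Thm. 16 (p. 397)] -/
theorem padicLFunction_coeff_norm_lt_one_of_leaf_of_ramified_line
    (h57 : prop57_one_le_mu_of_ramified_odd_line) (hW16 : Wuthrich2014.charIdeal_dvd_padicLFunction)
    (hL : RankZero.Leaf W p) {Φ : AddSubgroup (geomTorsion W (p : ℤ))} (hΦ : IsRationalLine W p Φ)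
    (hram : ¬ LineUnramifiedAt W p Φ) {κ : ZpExtension ℚ p} {γ : Field.absoluteGaloisGroup ℚ}
    (hκ : κ.IsCyclotomic) (hγ : κ.IsTopGenerator γ) (hγ' : IsCyclotomicVariable p γ)
    [NeZero (W.conductorNorm ℤ)] {f : CuspForm (Gamma0 (W.conductorNorm ℤ)) 2} (hf : IsNewformOf W f)
    {ϖ : ℚ} (hϖ : (ϖ : ℝ) * W.realPeriodRat = plusPeriod f) (D : W.SelmerDualData κ γ) (n : ℕ) :
    ‖PowerSeries.coeff n
        (PowerSeries.C (ϖ : ℚ_[p]) * padicLFunction f (unitRoot W p : ℚ_[p]))‖ < 1 := by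
  haveI : Module.Finite (IwasawaAlgebra p) D.X := D.module_finite_holds hγ
  have hX := isClassX1_of_classX1 hL.classX1
  obtain ⟨hD, g', hg'mem, hι⟩ := hW16 W p hX.two_ne
    ⟨hX.hasGoodReductionAtPrime, hX.not_dvd_frobeniusTrace⟩ hX.not_hasIrreducibleModPGaloisRep
    hκ hγ hγ' hf D ϖ hϖ
  obtain ⟨g, hg⟩ := (charIdeal_isPrincipal_holds p D.X).principal
  have hchar : D.charIdeal = Ideal.span {g} := hg
  have hpg : PowerSeries.C (p : ℤ_[p]) ∣ g :=
    h57.C_dvd_of_charIdeal_eq W p hX.two_ne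
      (Or.inl ⟨hX.hasGoodReductionAtPrime, hX.not_dvd_frobeniusTrace⟩) hΦ hram
      (lineOdd_of_not_gvPar_of_ramified hL.not_gvPar hΦ hram) hκ hγ D hD hchar
  have hgg' : g ∣ g' := by
    rw [hchar] at hg'mem
    exact Ideal.mem_span_singleton.mp hg'mem
  rw [← hι]
  exact norm_coeff_map_lt_one_of_C_dvd (hpg.trans hgg') n

/-- **Summary on the leaf (the μ-dichotomy of a type-A class, kernel form).** At a leaf pair,
granted Greenberg Prop. 5.7 (`h57`) and Wuthrich Thm. 16 (`hW16`): EITHER every rational line of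
the curve is unramified at `p` and even (a `φ`-member: Greenberg's conjecture predicts `μ = 0`, no
published theorem), OR the curve has a ramified odd line and then `μ(X(E/ℚ_∞)) ≥ 1` for every
cyclotomic dual datum — so Greenberg–Vatsal's `μ_alg = μ_an = 0` conclusion (the engine of covered
row C7) holds at NO such member. [cite: GreenbergLNM1716, Props. 5.7, 5.10 (PDF pp. 139, 147)]
[cite: Wuthrich2014, Thm. 16 (p. 397)] -/
theorem leaf_mu_dichotomy (h57 : prop57_one_le_mu_of_ramified_odd_line)
    (hW16 : Wuthrich2014.charIdeal_dvd_padicLFunction) (hL : RankZero.Leaf W p)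
    {κ : ZpExtension ℚ p} {γ : Field.absoluteGaloisGroup ℚ}
    (hκ : κ.IsCyclotomic) (hγ : κ.IsTopGenerator γ) (hγ' : IsCyclotomicVariable p γ)
    [NeZero (W.conductorNorm ℤ)] {f : CuspForm (Gamma0 (W.conductorNorm ℤ)) 2} (hf : IsNewformOf W f)
    {ϖ : ℚ} (hϖ : (ϖ : ℝ) * W.realPeriodRat = plusPeriod f) :
    (∀ Φ : AddSubgroup (geomTorsion W (p : ℤ)), IsRationalLine W p Φ →
        LineUnramifiedAt W p Φ ∧ LineEven W p Φ) ∨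
      ∀ D : W.SelmerDualData κ γ, 1 ≤ D.mu := by
  by_cases h : ∃ Φ : AddSubgroup (geomTorsion W (p : ℤ)), IsRationalLine W p Φ ∧ ¬ LineUnramifiedAt W p Φ
  · obtain ⟨Φ, hΦ, hram⟩ := h
    right
    intro D
    have hX := isClassX1_of_classX1 hL.classX1
    obtain ⟨hD, -⟩ := hW16 W p hX.two_ne
      ⟨hX.hasGoodReductionAtPrime, hX.not_dvd_frobeniusTrace⟩ hX.not_hasIrreducibleModPGaloisRep
      hκ hγ hγ' hf D ϖ hϖ
    exact one_le_mu_of_leaf_of_ramified_line h57 hL hΦ hram hκ hγ D hD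
  · left
    intro Φ hΦ
    have hunr : LineUnramifiedAt W p Φ := by
      by_contra hram
      exact h ⟨Φ, hΦ, hram⟩
    exact ⟨hunr, lineEven_of_not_gvPar_of_unramified hL.not_gvPar hΦ hunr⟩

end Summit.BirchSwinnertonDyer.Rank1Residual.X1.MuStructure

end
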